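import Summits.BirchSwinnertonDyer.Rank1Residual.Additive.SignedTwistLocalTower
import Literature.Barriers.BirchSwinnertonDyer.DescentDefectUnboundedMatsunoKerResProofs
import Mathlib.NumberTheory.Cyclotomic.Gal
import HarnessLib

/-!
# Route `QuadraticBranchSignedControl` (rung K8, cell `bsd-potss`), crux `EtaTransportSigned`
# (item stmt-BirchSwinnertonDyer-19115): the crux's abstract quadratic character `ηq` of
# `Gal(K₀/ℚ)`, `K₀ = ℚ(μ_p)`, IS the sign character of any square root in `K₀` (brick (U))

WHY. The crux `EtaTransportSigned` (both stubs) quantifies over an ABSTRACT character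
`ηq : Γ_ℚ →* ℤˣ`, trivial on `Gal(ℚ̄/K₀)` for a `p`-th cyclotomic field `K₀` and non-trivial — the
shape of x1b's frames `h74`/`hKO`/`hMC`. Every dictionary theorem of the cell (`SignedTwist*`:
(D3⁺), the tower twist, the invariant part) is keyed instead on a CONCRETE sign character
`hη : η σ = 1 ↔ σ • t = t` of a square root `t = rootInClosure K₀ θ ∈ ℚ̄` (`θ ∈ K₀ ∖ ℚ`,
`θ² = c`; for `c = p*` Kobayashi's `η = ω^{(p−1)/2}`). To USE those theorems when PROVING the crux
one needs: **the two characters coincide** — `Gal(K₀/ℚ) ≅ (ℤ/p)ˣ` is cyclic, so it has exactly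
one non-trivial `{±1}`-valued character.
* `eq_of_ne_one_of_galRange_le_ker` — two non-trivial characters `Γ_ℚ →* ℤˣ` trivial on
  `Gal(ℚ̄/K₀)`, `K₀/ℚ` normal with CYCLIC Galois group, are equal (they factor through the cyclic
  quotient `Γ_ℚ/Gal(ℚ̄/K₀)`, where a `{±1}`-character is pinned by its value `−1` on a generator);
* `isCyclic_aut_of_isCyclotomicExtension` — `Gal(K₀/ℚ)` is cyclic for `K₀` a `p`-th cyclotomic
  field (Mathlib: `autEquivPow : Gal ≃* (ℤ/p)ˣ`, units of a finite field);
* **`eta_eq_one_iff_smul_rootInClosure`** — for such `K₀`, ANY `θ ∈ K₀ ∖ ℚ` with `θ² = c ∈ ℚ` and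
  ANY non-trivial `ηq` trivial on `Gal(ℚ̄/K₀)`: `ηq σ = 1 ↔ σ • rootInClosure K₀ θ = rootInClosure K₀ θ`
  (x1b's binder `hη`, now for the crux's `ηq`).
Brick (U) of the decomposition frame `hdec` of
`Theorems/QuadraticBranchSignedControlEtaTransportPlusOfDecomposition.lean`.

HONEST FRAMING (cell `bsd-potss`, run/shared/lean/pub/bsd-potss/; FULL-BSD rank ≤ 1 programme):
TOOL THEOREMS ONLY (Galois bookkeeping) — no definition, no named Literature fact, no `sorry`,
axioms standard; UNCONDITIONAL. Nothing about (C1_η), Kobayashi's theorems or `BSD(W, p)` is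
claimed; no label or count moves. Seat `bsd-potss-k8q-c3` (prover), g0.

References: [Kobayashi2003] §3 p. 6 (`η : Δ → ℤ_p^×`), §4 p. 8 (`η = ω^{(p−1)/2}`, the character of
`ℚ(√p*) ⊂ ℚ(μ_p)`); [Washington1997] §2 (Gal(ℚ(ζ_p)/ℚ) ≅ (ℤ/p)ˣ cyclic); [SerreGaloisCohomology1997]
II.§1.1.
-/

set_option autoImplicit false
set_option linter.dupNamespace false

noncomputable section

open scoped Classical

open Field WeierstrassCurve
open Literature.NumberTheory.EllipticCurves
open Literature.NumberTheory.GaloisRepresentations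
open Summit.BirchSwinnertonDyer.Rank1Residual.Additive
open Summit.BirchSwinnertonDyer.Rank1Residual.AdditivePotMult

namespace Summit.BirchSwinnertonDyer.BirchSwinnertonDyer.Theorems

/-- A `{±1}`-valued character of a cyclic group which is not trivial takes the value `−1` on any
generator. [folklore] -/
theorem apply_generator_eq_neg_one_of_ne_one {G : Type*} [Group G] (χ : G →* ℤˣ) {g : G}
    (hg : ∀ x, x ∈ Subgroup.zpowers g) (hχ : χ ≠ 1) : χ g = -1 := by
  rcases Int.units_eq_one_or (χ g) with h | h
  · exfalso
    apply hχ
    ext x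
    obtain ⟨k, rfl⟩ := Subgroup.mem_zpowers_iff.mp (hg x)
    rw [map_zpow, h, one_zpow, MonoidHom.one_apply]
  · exact h

/-- Two non-trivial `{±1}`-valued characters of a CYCLIC group are equal. [folklore] -/
theorem eq_of_ne_one_of_isCyclic {G : Type*} [Group G] [IsCyclic G] (χ₁ χ₂ : G →* ℤˣ)
    (h₁ : χ₁ ≠ 1) (h₂ : χ₂ ≠ 1) : χ₁ = χ₂ := by
  obtain ⟨g, hg⟩ := IsCyclic.exists_generator (α := G)
  ext x
  obtain ⟨k, rfl⟩ := Subgroup.mem_zpowers_iff.mp (hg x)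
  rw [map_zpow, map_zpow, apply_generator_eq_neg_one_of_ne_one χ₁ hg h₁,
    apply_generator_eq_neg_one_of_ne_one χ₂ hg h₂]

/-- **Two non-trivial characters `Γ_k →* ℤˣ` trivial on `Gal(k̄/K)` coincide when `K/k` is normal
with cyclic Galois group**: they factor through `Γ_k / Gal(k̄/K)`, which embeds into `Gal(K/k)`
(`isCyclic_quotient_galRange`), hence is cyclic. [folklore] -/
theorem eq_of_ne_one_of_galRange_le_ker {k : Type} [Field k] (K : Type) [Field K] [Algebra k K]
    [Normal k K] [IsCyclic (K ≃ₐ[k] K)] [(galRange (K := k) K).Normal]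
    (χ₁ χ₂ : absoluteGaloisGroup k →* ℤˣ) (h₁ : ∀ σ ∈ galRange (K := k) K, χ₁ σ = 1) (h₁' : χ₁ ≠ 1)
    (h₂ : ∀ σ ∈ galRange (K := k) K, χ₂ σ = 1) (h₂' : χ₂ ≠ 1) : χ₁ = χ₂ := by
  haveI : IsCyclic (absoluteGaloisGroup k ⧸ galRange (K := k) K) :=
    Literature.Barriers.BirchSwinnertonDyer.isCyclic_quotient_galRange (k := k) K
  have hk₁ : galRange (K := k) K ≤ χ₁.ker := fun σ hσ => by rw [MonoidHom.mem_ker]; exact h₁ σ hσ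
  have hk₂ : galRange (K := k) K ≤ χ₂.ker := fun σ hσ => by rw [MonoidHom.mem_ker]; exact h₂ σ hσ
  have hl₁ : (QuotientGroup.lift (galRange (K := k) K) χ₁ hk₁).comp (QuotientGroup.mk' _) = χ₁ :=
    QuotientGroup.lift_comp_mk' _ _ hk₁
  have hl₂ : (QuotientGroup.lift (galRange (K := k) K) χ₂ hk₂).comp (QuotientGroup.mk' _) = χ₂ :=
    QuotientGroup.lift_comp_mk' _ _ hk₂
  have hne₁ : QuotientGroup.lift (galRange (K := k) K) χ₁ hk₁ ≠ 1 := fun h => h₁' (by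
    rw [← hl₁, h]; rfl)
  have hne₂ : QuotientGroup.lift (galRange (K := k) K) χ₂ hk₂ ≠ 1 := fun h => h₂' (by
    rw [← hl₂, h]; rfl)
  rw [← hl₁, ← hl₂, eq_of_ne_one_of_isCyclic _ _ hne₁ hne₂]

/-- `Gal(K₀/ℚ)` is cyclic for a `p`-th cyclotomic field `K₀` (`≅ (ℤ/p)ˣ`, the units of a finite
field). [cite: Washington1997, §2 (Thm. 2.5: Gal(ℚ(ζ_n)/ℚ) ≅ (ℤ/n)ˣ)] -/
theorem isCyclic_aut_of_isCyclotomicExtension (p : ℕ) [Fact p.Prime] (K₀ : Type) [Field K₀]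
    [NumberField K₀] [IsCyclotomicExtension {p} ℚ K₀] : IsCyclic (K₀ ≃ₐ[ℚ] K₀) := by
  haveI : NeZero (p : ℚ) := ⟨by exact_mod_cast (Fact.out : p.Prime).ne_zero⟩
  have hirr : Irreducible (Polynomial.cyclotomic p ℚ) :=
    Polynomial.cyclotomic.irreducible_rat (Fact.out : p.Prime).pos
  exact isCyclic_of_surjective (IsCyclotomicExtension.autEquivPow K₀ hirr).symm
    (IsCyclotomicExtension.autEquivPow K₀ hirr).symm.surjective

/-- **(U) The crux's abstract `ηq` IS the sign character of any square root in `K₀ = ℚ(μ_p)`.**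
For a `p`-th cyclotomic field `K₀`, `θ ∈ K₀ ∖ ℚ` with `θ² = c ∈ ℚ`, and any non-trivial
`ηq : Γ_ℚ →* ℤˣ` trivial on `Gal(ℚ̄/K₀)`: `ηq σ = 1 ↔ σ` fixes `t = rootInClosure K₀ θ` — x1b's
binder `hη` (file `SignedTwistRoot`, [SIGN]) for the crux's character. Proof: the sign character
`η_t` of `t` (`exists_eta_iff_smul_rootInClosure`) is trivial on `Gal(ℚ̄/K₀)`
(`apply_rootInClosure_of_mem`) and non-trivial (`exists_smul_rootInClosure_ne`); `Gal(K₀/ℚ)` is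
cyclic, so `ηq = η_t`. [cite: Kobayashi2003, §4 p. 8 (η = ω^{(p−1)/2}, the character of ℚ(√p*) ⊂ ℚ(μ_p))]
[cite: Washington1997, §2] -/
theorem eta_eq_one_iff_smul_rootInClosure (p : ℕ) [Fact p.Prime] (K₀ : Type) [Field K₀]
    [NumberField K₀] [IsCyclotomicExtension {p} ℚ K₀] [(galRange (K := ℚ) K₀).Normal]
    {θ : K₀} {c : ℚ} (hθ : θ ∉ Set.range (algebraMap ℚ K₀)) (hc : θ ^ 2 = algebraMap ℚ K₀ c)
    (ηq : absoluteGaloisGroup ℚ →* ℤˣ) (hηK : ∀ σ ∈ galRange (K := ℚ) K₀, ηq σ = 1) (hη1 : ηq ≠ 1)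
    (σ : absoluteGaloisGroup ℚ) :
    ηq σ = 1 ↔ σ • rootInClosure K₀ θ = rootInClosure K₀ θ := by
  obtain ⟨ηt, hηt⟩ := SignedTwist.exists_eta_iff_smul_rootInClosure K₀ hθ hc
  have hηtK : ∀ σ ∈ galRange (K := ℚ) K₀, ηt σ = 1 := fun σ hσ =>
    (hηt σ).mpr (apply_rootInClosure_of_mem K₀ hσ)
  have hηt1 : ηt ≠ 1 := by
    obtain ⟨τ, hτ⟩ := SignedTwist.exists_smul_rootInClosure_ne K₀ hθ
    intro h
    exact hτ ((hηt τ).mp (by rw [h, MonoidHom.one_apply]))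
  haveI : IsCyclic (K₀ ≃ₐ[ℚ] K₀) := isCyclic_aut_of_isCyclotomicExtension p K₀
  haveI : NeZero (p : ℚ) := ⟨by exact_mod_cast (Fact.out : p.Prime).ne_zero⟩
  haveI : IsGalois ℚ K₀ := IsCyclotomicExtension.isGalois {p} ℚ K₀
  rw [eq_of_ne_one_of_galRange_le_ker K₀ ηq ηt hηK hη1 hηtK hηt1]
  exact hηt σ

end Summit.BirchSwinnertonDyer.BirchSwinnertonDyer.Theorems

end
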